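import Summits.QuantumFields.BalabanUV.Beta.D1BFx.CombHessTableMass

/-!
# `BalabanUV.Beta.D1BFx.CombBorderTablePairMass` — road «BF-x» for binder row D1, slot (K) ∕ junction (J1), direction RE-TABLE (R-D1-g55-1: the road carries the COMB
# scheme's table record, whose FIRST-order member is an1's ROOTED comb border table `V := vhSAt ρ_c = packVH m^ρ`), «COMB-BORDER-TABLE-PAIRMASS»: **THE PAIR `ℓ¹` MASS
# OF an1's ROOTED COMB BORDER TABLE (product chart) IS `Σ_{f ∈ S₁} Σ_{f′ ∈ S₂} |m^ρ_{(μ,y)}(f, f′)| ≤ 3ℓ²` FOR ALL FINITE BOND SETS — THE SAME NUMBER THAT BOUNDS ONE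
# ENTRY (an1's `abs_vhKerAt_le`)**; the comb twin of gan24-leaf-05 g63's PART B `SymHessTableMass` §6 (`sum_sum_abs_symVhCountAt_le ∕ sum_sum_abs_symVhKerAt_le`), the
# piece gan24-leaf-05 g65's «COMB-H-TABLE-MASS» `CombHessTableMass` leaves «on word» (its header: «NOT HERE: the border product-chart pair mass (`vhKerAt`; on word)»)

HONEST DEPENDENCY (cell records, verbatim): «continuum YM on T⁴ ⇐ BetaPertH ∧ nine spine estimates (0/9 proved); BetaPertH ⇐ (D1) ∧ (D4) ∧
CAP+tail; G-an2-4 gates asym, D1 and NE2/3/4.»  HONEST FRAMING (cell contract, verbatim): «discharging `BetaPertH` makes Bałaban's UV stability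
UNCONDITIONAL — a real constructive-QFT result; it is NOT the continuum limit and NOT the Clay problem.»  THIS MODULE DISCHARGES NOTHING of the
wall: [folklore] `Finset` bookkeeping BY NAME over the an1-lineage Literature node 7aρ `AveragingHessianKernelsRooted` (`vhCountAt = L^d·h + L^d·diag(q¹) − q¹·q¹`,
`vhKerAt = count∕(2L^{2d})`) and gan24-leaf-05's «COMB-H-TABLE-MASS» `CombHessTableMass.sum_sum_abs_hessCountAt_le ∕ sum_abs_linCountAt_le` (the comb Hessian pair mass
`4·L^d·ℓ²` and the comb linear single mass `L^d·ℓ`).  No definition, no `def … : Prop`, nothing cited, NO printed hypothesis, 0 sorry, default heartbeats.  A TABLE LETTER: it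
prices NO word, proves NO (1.22) row and says NOTHING about condition (B) of R-D1-g54-1∕g55-1; 0 root-level binders of row D1 discharged (hW ∕ hR ∕ D1Tel ∕ D1Rep); (J1) ONE
OPEN ROW; (K) NOT closed; NOT D1, NEVER «G-an2-4 closed», NOT `BetaPertH`, NOT continuum, NOT Clay.

ABSOLUTE RULE (cell charter, verbatim): «No internally-minted statement may enter as a cited fact. Every hypothesis is either kernel-proved in
this package or a verbatim quotation of a PUBLISHED theorem with page reference. The manuscript(s) under audit are NOT citable for their own
disputed steps — they are the thing under adjudication; programme-internal (2001/route/tribunal) claims are never citable.»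

WHY (located).  Under RE-TABLE (R-D1-g55-1 (2)) the road's first-order slot reads `(−n⁸∕2) • vhSAt ρ_c` where the literal reads `symVhSAt ρ_c` (d1-leaf-03 g38 X6-a, journal
l.60523; N-g36-1 §2 (c2): the (lamf)-type table-difference bracket's only new letter is a σ-weighted block mass of the border tables); any block ∕ fibre mass of the packed
comb border table `vhSAt ρ_c = packVH m^ρ` takes the PAIR MASS of `m^ρ = vhKerAt ρ_c` as its table-specific input — this file.  The packing-level masses themselves (the comb
twins of d1-leaf-04's «SYMMIX ∕ SYMT2-MASS» files) are NOT here: d1-leaf-04's lane by first refusal.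

CONTENT (all [folklore], generic `d`, box root `ρ = toSite r`, `r ∈ box d L`, `1 ≤ L`).
* `sum_sum_abs_vhCountAt_le` (`Σ_{f∈S₁}Σ_{f′∈S₂} |vhCountAt (toSite r) L μ y f f′| ≤ 6·L^{2d}·ℓ²`: `L^d ×` the comb Hessian pair mass + the diagonal linear word + the product of two
  linear single masses, `ℓ ≤ ℓ²`), **`sum_sum_abs_vhKerAt_le`** (`Σ_{f∈S₁}Σ_{f′∈S₂} |vhKerAt (toSite r) L μ y f f′| ≤ 3·(ell d L)²`).
Unit `b2b-balaban-beta-d1-formalise-leaf-03` (gen 39), D1 formalisation swarm leaf prover 03, road «BF-x»; OFFER O-g39-2 «COMB-BORDER-TABLE-PAIRMASS» (journal).  Not in print;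
our bookkeeping.  No existing file touched.
-/

noncomputable section

open Finset
open scoped BigOperators Nat
open Literature.MathematicalPhysics.QuantumFieldTheory
open Literature.MathematicalPhysics.QuantumFieldTheory.Balaban1983to89
open Literature.MathematicalPhysics.QuantumFieldTheory.Balaban1983to89.Beta
open Literature.MathematicalPhysics.QuantumFieldTheory.Balaban1983to89.Beta.AffineAveraging
open Literature.MathematicalPhysics.QuantumFieldTheory.Balaban1983to89.Beta.TransportedContourVariables
open Literature.MathematicalPhysics.QuantumFieldTheory.Balaban1983to89.Beta.AveragingHessianKernels

namespace Summit.QuantumFields.BalabanUV.Beta.D1BFx.CombBorderTablePairMass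

open Literature.MathematicalPhysics.QuantumFieldTheory.Balaban1983to89.Beta.AveragingHessianKernelsRooted (linCountAt hessCountAt vhCountAt vhKerAt)
open Summit.QuantumFields.BalabanUV.Beta.D1BFx.CombHessTableMass (sum_sum_abs_hessCountAt_le sum_abs_linCountAt_le)

variable {d : ℕ} {L : ℕ} {r : Fin d → ℕ}

/-- [folklore] **PAIR MASS OF THE ROOTED COMB BORDER COUNT `m^ρ` (product chart)**: `Σ_{f ∈ S₁} Σ_{f′ ∈ S₂} |vhCountAt ρ L μ y f f′| ≤ 6·L^{2d}·ℓ²` (`L^d ×` the comb Hessian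
pair mass `4·L^d·ℓ²` + `L^d ×` the diagonal linear word `≤ L^d·ℓ` + the product of two linear single masses `(L^d·ℓ)²`, and `ℓ ≤ ℓ²`). -/
theorem sum_sum_abs_vhCountAt_le (hL : 1 ≤ L) (hr : r ∈ box d L) (μ : Fin d) (y : Site d) (S₁ S₂ : Finset (Bond d)) :
    ∑ f ∈ S₁, ∑ f' ∈ S₂, |vhCountAt (toSite r) L μ y f f'| ≤ 6 * (L : ℤ) ^ (2 * d) * (ell d L : ℤ) ^ 2 := by
  classical
  have hℓ : (L : ℤ) ≤ ell d L := by exact_mod_cast le_ell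
  have hL0 : (0 : ℤ) ≤ L := by positivity
  have hLd : (0 : ℤ) ≤ (L : ℤ) ^ d := by positivity
  have hLd1 : (1 : ℤ) ≤ (L : ℤ) ^ d := by exact_mod_cast Nat.one_le_pow _ _ hL
  have hℓ0 : (0 : ℤ) ≤ ell d L := hL0.trans hℓ
  have hH := sum_sum_abs_hessCountAt_le hL hr μ y S₁ S₂
  have hA₁ := sum_abs_linCountAt_le hL hr μ y S₁
  have hA₂ := sum_abs_linCountAt_le hL hr μ y S₂
  have hA₂n : 0 ≤ ∑ f ∈ S₂, |linCountAt (toSite r) L μ y f| := Finset.sum_nonneg fun _ _ => abs_nonneg _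
  have h2d : (L : ℤ) ^ (2 * d) = (L : ℤ) ^ d * (L : ℤ) ^ d := by rw [two_mul, pow_add]
  -- the diagonal word is supported on `f = f′`: summed over `f′ ∈ S₂` it is at most `|q¹(f)|`
  have hdiag : ∑ f ∈ S₁, ∑ f' ∈ S₂, |(if f = f' then linCountAt (toSite r) L μ y f else 0)| ≤ (L : ℤ) ^ d * (ell d L : ℤ) := by
    calc ∑ f ∈ S₁, ∑ f' ∈ S₂, |(if f = f' then linCountAt (toSite r) L μ y f else 0)|
        ≤ ∑ f ∈ S₁, |linCountAt (toSite r) L μ y f| := by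
          refine Finset.sum_le_sum fun f _ => ?_
          have h1 : ∀ f' ∈ S₂, |(if f = f' then linCountAt (toSite r) L μ y f else 0)|
              = if f = f' then |linCountAt (toSite r) L μ y f| else 0 := by
            intro f' _
            split_ifs
            · rfl
            · rw [abs_zero]
          rw [Finset.sum_congr rfl h1, Finset.sum_ite_eq]
          split_ifs
          · exact le_rfl
          · exact abs_nonneg _
      _ ≤ (L : ℤ) ^ d * (ell d L : ℤ) := hA₁
  have hterm : ∀ f f' : Bond d, |vhCountAt (toSite r) L μ y f f'|
      ≤ (L : ℤ) ^ d * |hessCountAt (toSite r) L μ y f f'|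
        + (L : ℤ) ^ d * |(if f = f' then linCountAt (toSite r) L μ y f else 0)|
        + |linCountAt (toSite r) L μ y f| * |linCountAt (toSite r) L μ y f'| := by
    intro f f'
    rw [vhCountAt]
    refine (abs_sub _ _).trans (add_le_add ((abs_add_le _ _).trans (add_le_add ?_ ?_)) ?_)
    · rw [abs_mul, abs_of_nonneg hLd]
    · rw [abs_mul, abs_of_nonneg hLd]
    · rw [abs_mul]
  calc ∑ f ∈ S₁, ∑ f' ∈ S₂, |vhCountAt (toSite r) L μ y f f'|
      ≤ ∑ f ∈ S₁, ∑ f' ∈ S₂, ((L : ℤ) ^ d * |hessCountAt (toSite r) L μ y f f'|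
        + (L : ℤ) ^ d * |(if f = f' then linCountAt (toSite r) L μ y f else 0)|
        + |linCountAt (toSite r) L μ y f| * |linCountAt (toSite r) L μ y f'|) :=
        Finset.sum_le_sum fun f _ => Finset.sum_le_sum fun f' _ => hterm f f'
    _ = (L : ℤ) ^ d * (∑ f ∈ S₁, ∑ f' ∈ S₂, |hessCountAt (toSite r) L μ y f f'|)
        + (L : ℤ) ^ d * (∑ f ∈ S₁, ∑ f' ∈ S₂, |(if f = f' then linCountAt (toSite r) L μ y f else 0)|)
        + (∑ f ∈ S₁, |linCountAt (toSite r) L μ y f|) * (∑ f' ∈ S₂, |linCountAt (toSite r) L μ y f'|) := by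
        rw [Finset.sum_mul_sum, Finset.mul_sum, Finset.mul_sum, ← Finset.sum_add_distrib, ← Finset.sum_add_distrib]
        refine Finset.sum_congr rfl fun f _ => ?_
        rw [Finset.mul_sum, Finset.mul_sum, ← Finset.sum_add_distrib, ← Finset.sum_add_distrib]
    _ ≤ (L : ℤ) ^ d * (4 * (L : ℤ) ^ d * (ell d L : ℤ) ^ 2) + (L : ℤ) ^ d * ((L : ℤ) ^ d * (ell d L : ℤ))
        + ((L : ℤ) ^ d * (ell d L : ℤ)) * ((L : ℤ) ^ d * (ell d L : ℤ)) :=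
        add_le_add (add_le_add (mul_le_mul_of_nonneg_left hH hLd) (mul_le_mul_of_nonneg_left hdiag hLd)) (mul_le_mul hA₁ hA₂ hA₂n (by positivity))
    _ ≤ 6 * (L : ℤ) ^ (2 * d) * (ell d L : ℤ) ^ 2 := by
        rw [h2d]
        have h1 : (ell d L : ℤ) ≤ (ell d L : ℤ) ^ 2 := by nlinarith
        nlinarith [mul_nonneg hLd hLd, mul_le_mul_of_nonneg_left h1 (mul_nonneg hLd hLd)]

/-- [folklore] **PAIR `ℓ¹` MASS OF THE ROOTED COMB BORDER TABLE `m^ρ`: `Σ_{f ∈ S₁} Σ_{f′ ∈ S₂} |vhKerAt (toSite r) L μ y f f′| ≤ 3ℓ²`** (box root, `1 ≤ L`) — the number of an1's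
entrywise `abs_vhKerAt_le`; the table-specific input of any σ-weighted block mass of the packed comb border table `vhSAt ρ_c = packVH m^ρ`. -/
theorem sum_sum_abs_vhKerAt_le (hL : 1 ≤ L) (hr : r ∈ box d L) (μ : Fin d) (y : Site d) (S₁ S₂ : Finset (Bond d)) :
    ∑ f ∈ S₁, ∑ f' ∈ S₂, |vhKerAt (toSite r) L μ y f f'| ≤ 3 * (ell d L : ℝ) ^ 2 := by
  have hden : (0 : ℝ) < 2 * (L : ℝ) ^ (2 * d) := by positivity
  have h := sum_sum_abs_vhCountAt_le hL hr μ y S₁ S₂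
  have h' : (∑ f ∈ S₁, ∑ f' ∈ S₂, |(vhCountAt (toSite r) L μ y f f' : ℝ)|) ≤ 6 * (L : ℝ) ^ (2 * d) * (ell d L : ℝ) ^ 2 := by exact_mod_cast h
  have e : ∀ f f' : Bond d, |vhKerAt (toSite r) L μ y f f'| = |(vhCountAt (toSite r) L μ y f f' : ℝ)| / (2 * (L : ℝ) ^ (2 * d)) := by
    intro f f'
    rw [vhKerAt, abs_div, abs_of_pos hden]
  simp_rw [e, ← Finset.sum_div]
  rw [div_le_iff₀ hden]
  nlinarith

end Summit.QuantumFields.BalabanUV.Beta.D1BFx.CombBorderTablePairMass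

end
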